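import Summits.CriticalPhenomena.PercolationContinuityZ3.Theorems.Transplant.SkelFrmFrom1RootHoldsQDKV
import Summits.CriticalPhenomena.PercolationContinuityZ3.Theorems.Transplant.SkelFrmQuasiBChoiceLinksPx
import Summits.CriticalPhenomena.PercolationContinuityZ3.Theorems.Transplant.SkelFrmQuasiBChoiceZonePx
import Summits.CriticalPhenomena.PercolationContinuityZ3.Theorems.Transplant.SkelFrmQuasiBChoiceZoneKPx
import Summits.CriticalPhenomena.PercolationContinuityZ3.Theorems.Transplant.PlanarSkeletonFrmQuasiDefs
import Summits.CriticalPhenomena.PercolationContinuityZ3.Theorems.Transplant.PlanarSkeletonFrmQuasiProx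
import Summits.CriticalPhenomena.PercolationContinuityZ3.Theorems.Transplant.PlanarSkeletonFrmQuasiProxies
import Summits.CriticalPhenomena.PercolationContinuityZ3.Theorems.Transplant.SkelFrmQuasi1ChoiceDefs
import Summits.CriticalPhenomena.PercolationContinuityZ3.Theorems.Transplant.SkelFrmQuasi1ParamsLBL
import Summits.CriticalPhenomena.PercolationContinuityZ3.Theorems.Transplant.SkelFrmQuasi1ParamsPO
import Summits.CriticalPhenomena.PercolationContinuityZ3.Theorems.Transplant.SkelFrmQuasiBChoiceAtQ
import Summits.CriticalPhenomena.PercolationContinuityZ3.Theorems.Transplant.SkelFrmQuasiBChoiceAtQ3V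
import Summits.CriticalPhenomena.PercolationContinuityZ3.Theorems.Transplant.SkelFrmQuasiBChoiceCellsV
import Summits.CriticalPhenomena.PercolationContinuityZ3.Theorems.Transplant.SkelFrmQuasiBChoiceDefs
import Summits.CriticalPhenomena.PercolationContinuityZ3.Theorems.Transplant.SkelFrmQuasiBChoiceDefsT
import Summits.CriticalPhenomena.PercolationContinuityZ3.Theorems.Transplant.SkelFrmQuasiBChoiceDefsV
import Summits.CriticalPhenomena.PercolationContinuityZ3.Theorems.Transplant.SkelFrmQuasiBChoiceLinks
import Summits.CriticalPhenomena.PercolationContinuityZ3.Theorems.Transplant.SkelFrmQuasiBChoiceNums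
import Summits.CriticalPhenomena.PercolationContinuityZ3.Theorems.Transplant.SkelFrmQuasiBParamsKitS
import Summits.CriticalPhenomena.PercolationContinuityZ3.Theorems.Transplant.SkelFrmQuasiBParamsLF
import Summits.CriticalPhenomena.PercolationContinuityZ3.Theorems.Transplant.SkelFrmQuasiBParamsLFA
import Summits.CriticalPhenomena.PercolationContinuityZ3.Theorems.Transplant.SkelFrmQuasiBParamsLO
import Summits.CriticalPhenomena.PercolationContinuityZ3.Theorems.Transplant.SkelFrmQuasiBParamsLOA
import Summits.CriticalPhenomena.PercolationContinuityZ3.Theorems.Transplant.SkelFrmQuasiBParamsSlotsRS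
import Summits.CriticalPhenomena.PercolationContinuityZ3.Theorems.Transplant.SkelFrmQuasi1SlotTypes
import Summits.CriticalPhenomena.PercolationContinuityZ3.Theorems.Transplant.SkelPhiRootLegBridgeKGV3Q
import Summits.CriticalPhenomena.PercolationContinuityZ3.Theorems.Transplant.SkelPhiQStepsN
import HarnessLib

/-!
# GEN-Q PORT (WAVE-Q table v0.8 section 2, row G258, U-level L?; captain R-6/R-7 2026-08-27: carrier token swap `PlanarSkeletonFrmFrom ↦ PlanarSkeletonFrmQuasi`)
# of the tree module «Transplant/SkelFrmFrom1RootHoldsQDKVPx» (sha256 a839aee25e4b7ff9…) onto the quasi-step carrier `PlanarSkeletonFrmQuasi` (p507026): «SkelFrmQuasi1RootHoldsQDKVPx»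

ORIGINAL TITLE: 

builds on p205010 (kernel theorem, internal audit signed; external expert review pending) — nothing in this file uses p205010; NOTHING is claimed about any open node
((N3-b), the end state).  Lane `prim-bschramm`, seat `prim-hp-8` (gen 62; GEN-Q pen, family BChoiceRoot*/1Root*/BParamsKit·Bridge; tool = captain gen-1 g4's port_genq.py R-14 + p3-g30 T1/T2 + stmt-g33 --force-keep).  Helper file (`--supports stmt-CriticalPhenomena-4575 --as helper`).
PORT RULES (U-wave r1–r4 re-used, GEN-Q hunk classes of p3-g29 #6136): declaration order, names and proof texts are those of «SkelFrmFrom1RootHoldsQDKVPx», byte-identical except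
(i) the carrier token `PlanarSkeletonFrmFrom ↦ PlanarSkeletonFrmQuasi` in binders, `namespace`/`end` lines and qualified names (module names `SkelFrmFrom… ↦ SkelFrmQuasi…`
in imports of already-ported rows); (ii) `Φ.step ↦ Φ.qstep` with the called Steps lemma replaced by its `…Q`/`_q` twin and the cost `Φ.M` threaded (none in this file unless
listed below); (iii) `Φ.cyl_connected ↦ Φ.cyl_reach` readers (none unless listed); (iv) graph-ball radii / window floors ×`Φ.M` (none unless listed).  HAND HUNK (L-KitS-1 readers): the kit integers of record are read at the window cost
`N := KS.NQ Φ` — KS0.R'0 ↦ KS0.R'0N κ Φ (KS.NQ Φ) ×25; KS0.j₁0 ↦ KS0.j₁0N κ Φ (KS.NQ Φ) ×4; KS0.kk0 ↦ KS0.kk0N κ Φ (KS.NQ Φ) ×2; KS0.reach0 ↦ KS0.reach0N ×1 (N first); KS0.kit0 ↦ KS0.kit0N ×14 (N first); KS0.r₀0 ↦ KS0.r₀0N ×17 (N first); KS0.j₀0 ↦ KS0.j₀0N ×4 (N first); KS0.R'0_eq κ Φ ↦ KS0.R'0N_eq κ Φ (KS.NQ Φ) ×6 (stmt-g33's G017 «SkelFrmQuasiBChoiceNums»,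 hp-8's «SkelFrmQuasiBParamsKitSN»).  Carrier-free
residents stay imported/exported from the original «SkelFrm1RootHoldsQDKVPx» exactly as in the FrmFrom port.  Docstrings and citations are the original's.

K-2 READER HUNKS (p3-g30, design owner, R-25 2026-08-27; this file was hp-8 g62's tool port, the hunks below make it a quasi K-2 reader — validated
rc 0 kept whole over the staged closure by the concat→slim→sorrify→shake rig): (ii) `hstepφ := steps_φL … ↦ hqφ := qStepsN_φL …` («SkelFrmQuasiBParamsLO»,
cost `Φ.M`) and every consumer takes `hqφ`: `weakSteps_fineA_at … hqφ`, the window corner via `Skelφ.QStepsN.exists_mem_graphBall_eq hqφ` («SkelPhiQStepsN»),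
the callee is the quasi binder row `Skelφ.rootChainF_of_bridgeSchedCV₃_q hlipφ hqφ …` («SkelPhiRootLegBridgeKGV3Q») instead of the unit-step one;
(iv)/(v) the kits are read at window cost `N := KS.NQ Φ` through the G017 API — `obtain ⟨-, hdD, hDρ, hKCmax, hT⟩ := KS0.kit0N_ok (KS.NQ Φ) …`,
`hPN := (KS0.kit0N_costs Φ … (kq := 10) le_rfl).1 : Φ.M·13 ≤ N`, bridge `hPNb := (KS0.kit0N_costs Φ … (kq := 0) (by norm_num)).2.2.1 : Φ.M ≤ N`,
`KS0.kit0N_sizes Φ (KS.NQ Φ)`, `KS0.hr₀_kit0N (KS.one_le_NQ Φ)`, `KS0.hreach_kit0N (KS.NQ Φ)`, `KS0.counts_atqN_root κ Φ (KS.NQ Φ)`, `KS0.hNk0N_at κ Φ (KS.NQ Φ)`,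
`KS0.tanOff_kit0N (KS.NQ Φ)`; the kit-shaped statements carry the quasi column `(kit).N · KS.KCmax` (hreach0, hDwb); the corridor depth rows are ×`Φ.M`:
binder `hRD{3} : (D₀ : ℤ) + Φ.M·(10+3)·(…) ≤ Rπ` and `hRdepth{3} : D₀ + Φ.M·(10+3)·‖z‖₁ ≤ Rπ`; the bridge window corner `hc1R : Φ.M·(|core1Lo 0| + |core1Lo 1|) ≤ Rπ`.
-/

noncomputable section

open MeasureTheory ProbabilityTheory
open scoped ENNReal Classical

namespace Summit.CriticalPhenomena.PercolationContinuityZ3.Theorems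

namespace Transplant

open Literature.Probability.Percolation Literature.Probability.LatticeModels SimpleGraph KNCells KNLevels ChainPlanar ChainPara
open Literature.Probability.Percolation.KozmaNitzan.Cells (oth sgOf)
open Literature.Barriers.CriticalPhenomena (graphBall graphBall_mono mem_graphBall_self)
open SkelConc (Consts)
open Skel (winGraph)
open SkelI (tanOff)
open Skelφ (rootFrame RootFootV TargetFootV pgSideHalfW)
open ChainPlanar (ScheduleNP BridgePrm BridgeOK)
open Skelφ.StepI (OutNS)

namespace PlanarSkeletonFrmQuasi

namespace NegB

open Neg

variable {κ : Consts} {V : Type} [DecidableEq V] [Countable V] {G : SimpleGraph V} [G.LocallyFinite] {Φ : PlanarSkeletonFrmQuasi G} {t : V} {p : unitInterval}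
  {hC : Φ.CylSubcritical p} {gv fv : Neg.FSlot} {Pv : PSlot} {Sv : SSlot} {cv hv : CSlot} {bv : BSlot} {O : OutNS V} {q : unitInterval}

set_option maxHeartbeats 1600000 in
/-- **THE SECOND-AXIS ROOT LEG AT THE CHOICE FUNCTION OF RECORD (V cells, seed-level zone), UNDER PROXIES** — GEN twin of `rootLegAt_frmQ3KV_snd`
(«SkelFrmFrom1RootHoldsQDKV»): `Φ.types = {t}` ↦ `hP : Φ.HasProxies t D`; zone family `Λ ∘ prox` at the seed level `k` («SkelFrmFromBChoiceZoneKPx»; seed radius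
`D + fatRadius k` in `hρπ` / `hR₁`; inside the radius-`RK mk + D` kit parallelogram), long links / hop prism at radius `RL + D`, and the (S0) apron kits, counts,
`R′ = R'0`, `r₀0`, `Rs` read at a KIT RECORD `Dk` and KIT INDEX `mkP` with `hRK : RK(O.merged, mk) + D ≤ RK(Dk, mkP)` (K-1 / K-2, «SkelFrmFromBParamsKitBump»);
floors `D ≤ n_L`, `D ≤ n_kit`, `D ≤ k` explicit (C-4).  Conclusion: the second-axis root-leg residue at the centre's own V cells, verbatim.
[cite: KozmaNitzan2024, §4 p. 28 ((32) at the root)] -/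
theorem rootLegAt_frmQ3KV_sndPx {κ : Consts} {V : Type} [DecidableEq V] [Countable V] {G : SimpleGraph V} [G.LocallyFinite] {Φ : PlanarSkeletonFrmQuasi G} {t : V} {p : unitInterval} {hC : Φ.CylSubcritical p} {gv : Neg.FSlot} {fv : Neg.FSlot} {Pv : PSlot} {Sv : SSlot} {cv : CSlot} {hv : CSlot} {bv : BSlot} {O : OutNS V} {q : unitInterval} (Lf : ℕ → ℕ) (hAt : (choiceAtQ3V κ Φ t p Pv gv fv Sv cv hv bv hC).AtQNQ O q) {D : ℕ} (hP : Φ.HasProxies t D)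
    (hp0 : 0 < (p : ℝ)) (hp1 : (p : ℝ) < 1) (mk : ℕ)
    -- UNDER PROXIES: the width floors (C-4) and THE KIT RECORD / KIT INDEX (K-1/K-2): apron kits, counts, `R′ = R'0`, `r₀0`, `Rs` are read at `(Dk, mkP)`
    (hnL : D ≤ nL κ Φ t p O.merged (gOf κ Φ t p O gv) (fOf κ Φ t p O fv)) (hnK : D ≤ KS.nKit O.merged mk) (hDk : D ≤ O.merged.k)
    (Dk : Skelφ.StepI.DataNS V) (mkP : ℕ) (hRK : KS.RK t O.merged mk + D ≤ KS.RK t Dk mkP)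
    -- the two corridors of record: the x-PREFIX (first-axis row set, SMALL run length `Nx ≈ 8–10`) and the y′-corridor (stmt-g20 `kgRows0_of`/`kgYRows0_of`)
    {ρx qqx Wx : ℕ} (HKx : Skelφ.KGRows (nL κ Φ t p O.merged (gOf κ Φ t p O gv) (fOf κ Φ t p O fv)) (ℓL κ Φ t p O.merged (gOf κ Φ t p O gv) (fOf κ Φ t p O fv)) (hL κ Φ t p O.merged (gOf κ Φ t p O gv) (fOf κ Φ t p O fv)) (vL κ Φ t p O.merged (gOf κ Φ t p O gv) (fOf κ Φ t p O fv)) (KS0.R'0N κ Φ (KS.NQ Φ) t p Dk mkP) ρx qqx Wx) (Nx : ℕ)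
    {ρy qqy Wy : ℕ} (HKy : Skelφ.KGYRows (nL κ Φ t p O.merged (gOf κ Φ t p O gv) (fOf κ Φ t p O fv)) (ℓL κ Φ t p O.merged (gOf κ Φ t p O gv) (fOf κ Φ t p O fv)) (hL κ Φ t p O.merged (gOf κ Φ t p O gv) (fOf κ Φ t p O fv)) (vL κ Φ t p O.merged (gOf κ Φ t p O gv) (fOf κ Φ t p O fv)) (KS0.R'0N κ Φ (KS.NQ Φ) t p Dk mkP) ρy qqy Wy) (Ny : ℕ)
    -- the window radius about the root: above both kits' late thresholds, below the four concentric radii; the seed radius rows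
    {Rπ Rb : ℕ} (hr₀R : KS0.r₀0N (KS.NQ Φ) t Dk mkP (RL κ Φ t p O gv fv + D) ≤ Rπ) (hr₀bR : KS0.r₀0N (KS.NQ Φ) t Dk mkP Rb ≤ Rπ)
    (hRQ : Rπ + 1 ≤ ((schedOfT κ Φ t p O.merged (gOf κ Φ t p O gv) (fOf κ Φ t p O fv) (cOf κ Φ t p O gv fv cv) (Sv κ Φ t p O.merged (gOf κ Φ t p O gv) (fOf κ Φ t p O fv) q))).rQ 0 0) (hRB : Rπ + 1 ≤ ((schedOfT κ Φ t p O.merged (gOf κ Φ t p O gv) (fOf κ Φ t p O fv) (cOf κ Φ t p O gv fv cv) (Sv κ Φ t p O.merged (gOf κ Φ t p O gv) (fOf κ Φ t p O fv) q))).rB 0 0 (((1 : Fin 2), true) : MDir))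
    (hRQ' : Rπ + 1 ≤ ((schedOfT κ Φ t p O.merged (gOf κ Φ t p O gv) (fOf κ Φ t p O fv) (cOf κ Φ t p O gv fv cv) (Sv κ Φ t p O.merged (gOf κ Φ t p O gv) (fOf κ Φ t p O fv) q))).rQ 0 ((0 : Site 2) + stepVec (((1 : Fin 2), true) : MDir))) (hRM : Rπ + 1 ≤ ((schedOfT κ Φ t p O.merged (gOf κ Φ t p O gv) (fOf κ Φ t p O fv) (cOf κ Φ t p O gv fv cv) (Sv κ Φ t p O.merged (gOf κ Φ t p O gv) (fOf κ Φ t p O fv) q))).rM 0 ((0 : Site 2) + stepVec (((1 : Fin 2), true) : MDir)))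
    (hρπ : D + Skelφ.fatRadius Φ.frame hC O.merged.k ≤ Rπ) (hRs5 : ∀ i, KS.Rs t Dk mkP + 1 ≤ 5 * ((fcellsV κ Φ t p O.merged (gOf κ Φ t p O gv) (fOf κ Φ t p O fv) (cOf κ Φ t p O gv fv cv) (hOf κ Φ t p O gv fv hv))).r i)
    -- the hop's prism rows (`∥ := 1`, `⊥ := 0`)
    -- the hop prism's fine footprint READ PLANARLY (J23: N1's `hkR/hfR` shape; p3-g17 `SkelFrmBChoiceHopFoot` discharges both rows): a reading row and a floor row
    {kR₀ kR₁ : ℤ} (hkR : ∀ w ∈ Skelφ.pgramPrismFin G (φL κ Φ t p O.D O.DT.toDataN O.ori (gOf κ Φ t p O gv) (fOf κ Φ t p O fv)) t (nL κ Φ t p O.merged (gOf κ Φ t p O gv) (fOf κ Φ t p O fv)) (hL κ Φ t p O.merged (gOf κ Φ t p O gv) (fOf κ Φ t p O fv)) (3 * (ℓL κ Φ t p O.merged (gOf κ Φ t p O gv) (fOf κ Φ t p O fv))) (RL κ Φ t p O gv fv + D), |fineA κ Φ t p O.merged (gOf κ Φ t p O gv) (fOf κ Φ t p O fv) (φL κ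 Φ t p O.D O.DT.toDataN O.ori (gOf κ Φ t p O gv) (fOf κ Φ t p O fv)) w 0| ≤ kR₀ ∧ |fineA κ Φ t p O.merged (gOf κ Φ t p O gv) (fOf κ Φ t p O fv) (φL κ Φ t p O.D O.DT.toDataN O.ori (gOf κ Φ t p O gv) (fOf κ Φ t p O fv)) w 1| ≤ kR₁)
    (hfR : kR₁ + 1 ≤ 5 * (((fcellsV κ Φ t p O.merged (gOf κ Φ t p O gv) (fOf κ Φ t p O fv) (cOf κ Φ t p O gv fv cv) (hOf κ Φ t p O gv fv hv))).r 1 : ℤ) ∧ kR₀ + 2 + (((fcellsV κ Φ t p O.merged (gOf κ Φ t p O gv) (fOf κ Φ t p O fv) (cOf κ Φ t p O gv fv cv) (hOf κ Φ t p O gv fv hv))).c 1 : ℤ) ≤ 5 * (((fcellsV κ Φ t p O.merged (gOf κ Φ t p O gv) (fOf κ Φ t p O fv) (cOf κ Φ t p O gv fv cv) (hOf κ Φ t p O gv fv hv))).r 0 : ℤ))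
    -- the FIRST landing vertex `c₁` (bridge landing, (R-37) placement), the prefix's numeric depth row, its sharp x-clearance rows (RegionLo)
    (c₁ : V) {D₀ : ℕ} (hc₁ : c₁ ∈ graphBall G t D₀)
    (hRD : (D₀ : ℤ) + Φ.M * (10 + 3) * (((Nx : ℤ) + 1) * (nL κ Φ t p O.merged (gOf κ Φ t p O gv) (fOf κ Φ t p O fv)) + Skelφ.kgZ₀ (nL κ Φ t p O.merged (gOf κ Φ t p O gv) (fOf κ Φ t p O fv)) (vL κ Φ t p O.merged (gOf κ Φ t p O gv) (fOf κ Φ t p O fv)) (KS0.R'0N κ Φ (KS.NQ Φ) t p Dk mkP) ρx qqx Nx (Skelφ.kgM₁ (nL κ Φ t p O.merged (gOf κ Φ t p O gv) (fOf κ Φ t p O fv)) (ℓL κ Φ t p O.merged (gOf κ Φ t p O gv) (fOf κ Φ t p O fv)) (hL κ Φ t p O.merged (gOf κ Φ t p O gv) (fOf κ Φ t p O fv)) (KS0.R'0N κ Φ (KS.NQ Φ) t p Dk mkP) ρx Wx Nx) (Skelφ.kgM₂ (nL κ Φ t p O.merged (gOf κ Φ t p O gv) (fOf κ Φ t p O fv))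 (ℓL κ Φ t p O.merged (gOf κ Φ t p O gv) (fOf κ Φ t p O fv)) (hL κ Φ t p O.merged (gOf κ Φ t p O gv) (fOf κ Φ t p O fv)) (vL κ Φ t p O.merged (gOf κ Φ t p O gv) (fOf κ Φ t p O fv)) (KS0.R'0N κ Φ (KS.NQ Φ) t p Dk mkP) ρx qqx Wx Nx) +
        Skelφ.kgZ₁ (nL κ Φ t p O.merged (gOf κ Φ t p O gv) (fOf κ Φ t p O fv)) (ℓL κ Φ t p O.merged (gOf κ Φ t p O gv) (fOf κ Φ t p O fv)) (hL κ Φ t p O.merged (gOf κ Φ t p O gv) (fOf κ Φ t p O fv)) (KS0.R'0N κ Φ (KS.NQ Φ) t p Dk mkP) ρx Wx Nx (Skelφ.kgM₁ (nL κ Φ t p O.merged (gOf κ Φ t p O gv) (fOf κ Φ t p O fv)) (ℓL κ Φ t p O.merged (gOf κ Φ t p O gv) (fOf κ Φ t p O fv)) (hL κ Φ t p O.merged (gOf κ Φ t p O gv) (fOf κ Φ t p O fv)) (KS0.R'0N κ Φ (KS.NQ Φ) t p Dk mkP) ρx Wx Nx) (Skelφ.kgWm₂ (nL κ Φ t p O.merged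 (gOf κ Φ t p O gv) (fOf κ Φ t p O fv)) (ℓL κ Φ t p O.merged (gOf κ Φ t p O gv) (fOf κ Φ t p O fv)) (hL κ Φ t p O.merged (gOf κ Φ t p O gv) (fOf κ Φ t p O fv)) (KS0.R'0N κ Φ (KS.NQ Φ) t p Dk mkP) ρx Wx Nx) (Skelφ.kgWp₂ (nL κ Φ t p O.merged (gOf κ Φ t p O gv) (fOf κ Φ t p O fv)) (ℓL κ Φ t p O.merged (gOf κ Φ t p O gv) (fOf κ Φ t p O fv)) (hL κ Φ t p O.merged (gOf κ Φ t p O gv) (fOf κ Φ t p O fv)) (KS0.R'0N κ Φ (KS.NQ Φ) t p Dk mkP) ρx Wx Nx) (Skelφ.kgM₂ (nL κ Φ t p O.merged (gOf κ Φ t p O gv) (fOf κ Φ t p O fv)) (ℓL κ Φ t p O.merged (gOf κ Φ t p O gv) (fOf κ Φ t p O fv)) (hL κ Φ t p O.merged (gOf κ Φ t p O gv) (fOf κ Φ t p O fv)) (vL κ Φ t p O.merged (gOf κ Φ t p O gv) (fOf κ Φ t p O fv)) (KS0.R'0N κ Φ (KS.NQ Φ) t p Dk mkP) ρx qqx Wx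 Nx)) ≤ Rπ)
    (hnR : (KS0.R'0N κ Φ (KS.NQ Φ) t p Dk mkP) ≤ (nL κ Φ t p O.merged (gOf κ Φ t p O gv) (fOf κ Φ t p O fv))) (hrow : (qqx : ℤ) + (Nx + 1) * (KS0.R'0N κ Φ (KS.NQ Φ) t p Dk mkP) + (((Skelφ.kgM₁ (nL κ Φ t p O.merged (gOf κ Φ t p O gv) (fOf κ Φ t p O fv)) (ℓL κ Φ t p O.merged (gOf κ Φ t p O gv) (fOf κ Φ t p O fv)) (hL κ Φ t p O.merged (gOf κ Φ t p O gv) (fOf κ Φ t p O fv)) (KS0.R'0N κ Φ (KS.NQ Φ) t p Dk mkP) ρx Wx Nx) : ℤ) + 1) * ((KS0.R'0N κ Φ (KS.NQ Φ) t p Dk mkP) + ρx + |(vL κ Φ t p O.merged (gOf κ Φ t p O gv) (fOf κ Φ t p O fv))|) + (nL κ Φ t p O.merged (gOf κ Φ t p O gv) (fOf κ Φ t p O fv)) ≤ ((Nx : ℤ) + 1) * (nL κ Φ t p O.merged (gOf κ Φ t p O gv) (fOf κ Φ t p O fv)))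
    (hX₁ : (KS.Rs t Dk mkP : ℤ) + qqx + (KS0.R'0N κ Φ (KS.NQ Φ) t p Dk mkP) + (nL κ Φ t p O.merged (gOf κ Φ t p O gv) (fOf κ Φ t p O fv)) < (φL κ Φ t p O.D O.DT.toDataN O.ori (gOf κ Φ t p O gv) (fOf κ Φ t p O fv)) c₁ 0 - (φL κ Φ t p O.D O.DT.toDataN O.ori (gOf κ Φ t p O gv) (fOf κ Φ t p O fv)) t 0)
    -- the SECOND landing vertex `c₂` (over the prefix's last core), the y′-corridor's numeric depth row
    (c₂ : V) {D₀' : ℕ} (hc₂ : c₂ ∈ graphBall G t D₀')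
    (hRD₃ : (D₀' : ℤ) + Φ.M * (10 + 3) * (((Ny : ℤ) + 1) * (((nL κ Φ t p O.merged (gOf κ Φ t p O gv) (fOf κ Φ t p O fv)) * (ℓL κ Φ t p O.merged (gOf κ Φ t p O gv) (fOf κ Φ t p O fv)) / Skelφ.shearUnit (nL κ Φ t p O.merged (gOf κ Φ t p O gv) (fOf κ Φ t p O fv)) (hL κ Φ t p O.merged (gOf κ Φ t p O gv) (fOf κ Φ t p O fv)) + 1 : ℕ) : ℤ) + Skelφ.kgZY₀ (nL κ Φ t p O.merged (gOf κ Φ t p O gv) (fOf κ Φ t p O fv)) (vL κ Φ t p O.merged (gOf κ Φ t p O gv) (fOf κ Φ t p O fv)) (KS0.R'0N κ Φ (KS.NQ Φ) t p Dk mkP) ρy Wy Ny (Skelφ.kgM₁Y (nL κ Φ t p O.merged (gOf κ Φ t p O gv) (fOf κ Φ t p O fv)) (vL κ Φ t p O.merged (gOf κ Φ t p O gv) (fOf κ Φ t p O fv)) (KS0.R'0N κ Φ (KS.NQ Φ) t p Dk mkP) ρy Wy Ny) (Skelφ.kgWm₂Y (nL κ Φ t p O.merged (gOf κ Φ t p O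 gv) (fOf κ Φ t p O fv)) (vL κ Φ t p O.merged (gOf κ Φ t p O gv) (fOf κ Φ t p O fv)) (KS0.R'0N κ Φ (KS.NQ Φ) t p Dk mkP) ρy Wy Ny) (Skelφ.kgWp₂Y (nL κ Φ t p O.merged (gOf κ Φ t p O gv) (fOf κ Φ t p O fv)) (vL κ Φ t p O.merged (gOf κ Φ t p O gv) (fOf κ Φ t p O fv)) (KS0.R'0N κ Φ (KS.NQ Φ) t p Dk mkP) ρy Wy Ny) (Skelφ.kgM₂Y (nL κ Φ t p O.merged (gOf κ Φ t p O gv) (fOf κ Φ t p O fv)) (ℓL κ Φ t p O.merged (gOf κ Φ t p O gv) (fOf κ Φ t p O fv)) (hL κ Φ t p O.merged (gOf κ Φ t p O gv) (fOf κ Φ t p O fv)) (vL κ Φ t p O.merged (gOf κ Φ t p O gv) (fOf κ Φ t p O fv)) (KS0.R'0N κ Φ (KS.NQ Φ) t p Dk mkP) ρy qqy Wy Ny) + Skelφ.kgZY₁ (nL κ Φ t p O.merged (gOf κ Φ t p O gv) (fOf κ Φ t p O fv)) (ℓL κ Φ t p O.merged (gOf κ Φ t p O gv) (fOf κ Φ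 t p O fv)) (hL κ Φ t p O.merged (gOf κ Φ t p O gv) (fOf κ Φ t p O fv)) (KS0.R'0N κ Φ (KS.NQ Φ) t p Dk mkP) ρy qqy Ny (Skelφ.kgM₁Y (nL κ Φ t p O.merged (gOf κ Φ t p O gv) (fOf κ Φ t p O fv)) (vL κ Φ t p O.merged (gOf κ Φ t p O gv) (fOf κ Φ t p O fv)) (KS0.R'0N κ Φ (KS.NQ Φ) t p Dk mkP) ρy Wy Ny) (Skelφ.kgM₂Y (nL κ Φ t p O.merged (gOf κ Φ t p O gv) (fOf κ Φ t p O fv)) (ℓL κ Φ t p O.merged (gOf κ Φ t p O gv) (fOf κ Φ t p O fv)) (hL κ Φ t p O.merged (gOf κ Φ t p O gv) (fOf κ Φ t p O fv)) (vL κ Φ t p O.merged (gOf κ Φ t p O gv) (fOf κ Φ t p O fv)) (KS0.R'0N κ Φ (KS.NQ Φ) t p Dk mkP) ρy qqy Wy Ny)) ≤ Rπ)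
    -- THE BRIDGE (stmt-g20 port of N1's `KS.BFs/BFd/BFt`, `bridgeData_*` over `inputsExtraAt_of_atQ`): frame, hop box = `B₀`, `R′`, core-1 box rows, seed
    -- clearance (R-F1), readings in the root frame at reach radius `Rb`, THE BRIDGE EVENT at accuracy `(κ.δr 0)³`
    (B : BridgePrm) (hB : BridgeOK B) (hB0 : B.B₀lo ≤ B.B₀hi) (hBR' : KS0.R'0N κ Φ (KS.NQ Φ) t p Dk mkP ≤ B.R')
    (hc1 : B.core1Lo ≤ B.core1Hi) (hc1R : Φ.M * ((B.core1Lo 0).natAbs + (B.core1Lo 1).natAbs) ≤ Rπ)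
    (hhopB : ∀ w ∈ pgSideHalfW G (φL κ Φ t p O.D O.DT.toDataN O.ori (gOf κ Φ t p O gv) (fOf κ Φ t p O fv)) t (nL κ Φ t p O.merged (gOf κ Φ t p O gv) (fOf κ Φ t p O fv)) (hL κ Φ t p O.merged (gOf κ Φ t p O gv) (fOf κ Φ t p O fv)) (ℓL κ Φ t p O.merged (gOf κ Φ t p O gv) (fOf κ Φ t p O fv)) (RL κ Φ t p O gv fv + D) 1 (1 * 1), rootFrame (φL κ Φ t p O.D O.DT.toDataN O.ori (gOf κ Φ t p O gv) (fOf κ Φ t p O fv)) t 1 w ∈ Finset.Icc B.B₀lo B.B₀hi)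
    (hclear₁ : (KS.Rs t Dk mkP : ℤ) < B.B₀lo 0 - B.R' - B.pr)
    (Qb Fb : V → Finset V)
    (hQb : ∀ c, ∀ w ∈ Qb c, w ∈ graphBall G c Rb ∧
      rootFrame (φL κ Φ t p O.D O.DT.toDataN O.ori (gOf κ Φ t p O gv) (fOf κ Φ t p O fv)) t 1 w ∈ Finset.Icc (rootFrame (φL κ Φ t p O.D O.DT.toDataN O.ori (gOf κ Φ t p O gv) (fOf κ Φ t p O fv)) t 1 c - ((B.pr : ℕ) : Site 2)) (rootFrame (φL κ Φ t p O.D O.DT.toDataN O.ori (gOf κ Φ t p O gv) (fOf κ Φ t p O fv)) t 1 c + ((B.pr : ℕ) : Site 2)))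
    (hFb : ∀ c, ∀ w ∈ Fb c, w ∈ Qb c ∧ rootFrame (φL κ Φ t p O.D O.DT.toDataN O.ori (gOf κ Φ t p O gv) (fOf κ Φ t p O fv)) t 1 w ∈ Finset.Icc (rootFrame (φL κ Φ t p O.D O.DT.toDataN O.ori (gOf κ Φ t p O gv) (fOf κ Φ t p O fv)) t 1 c + B.dlo) (rootFrame (φL κ Φ t p O.D O.DT.toDataN O.ori (gOf κ Φ t p O gv) (fOf κ Φ t p O fv)) t 1 c + B.dhi))
    (hbridge : ∀ c, 1 - κ.δr 0 ^ 3 < (bondPercolation G q).real (linkIn (↑(Qb c) : Set V) (O.merged.Λ (hP.prox c) O.merged.k) (Fb c)))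
    -- ROOM ROWS at the root cell (hp-8 g40 RootRoomsS / p5-g16 readings): footprints of the bridge region, of BOTH corridors' regions, of the last core;
    -- the y′-corridor's TWO-DIMENSIONAL seed clearance (ONE row until p5-g16's `kgCorrSchedY_region_bounds`); the two cross links; the cut world's diameter
    (hfoot₁ : ∀ w ∈ graphBall G t Rπ, rootFrame (φL κ Φ t p O.D O.DT.toDataN O.ori (gOf κ Φ t p O gv) (fOf κ Φ t p O fv)) t 1 w ∈ Finset.Icc B.regionLo B.regionHi → RootFootV (fcellsV κ Φ t p O.merged (gOf κ Φ t p O gv) (fOf κ Φ t p O fv) (cOf κ Φ t p O gv fv cv) (hOf κ Φ t p O gv fv hv)) (((1 : Fin 2), true) : MDir) ((fineOA κ Φ t p O.D O.DT.toDataN O.ori (gOf κ Φ t p O gv) (fOf κ Φ t p O fv)) w))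
    (hfoot₂ : ∀ k ≤ (Skelφ.kgCorrSched (HKx.kgVals_ok₁ Nx) (HKx.kgVals_ok₂ Nx) (HKx.kgVals_split Nx)).N, ∀ w ∈ graphBall G t Rπ, Skelφ.runX (φL κ Φ t p O.D O.DT.toDataN O.ori (gOf κ Φ t p O gv) (fOf κ Φ t p O fv)) c₁ (nL κ Φ t p O.merged (gOf κ Φ t p O gv) (fOf κ Φ t p O fv)) (hL κ Φ t p O.merged (gOf κ Φ t p O gv) (fOf κ Φ t p O fv)) 1 w ∈ (Skelφ.kgCorrSched (HKx.kgVals_ok₁ Nx) (HKx.kgVals_ok₂ Nx) (HKx.kgVals_split Nx)).region k → RootFootV (fcellsV κ Φ t p O.merged (gOf κ Φ t p O gv) (fOf κ Φ t p O fv) (cOf κ Φ t p O gv fv cv) (hOf κ Φ t p O gv fv hv)) (((1 : Fin 2), true) : MDir) ((fineOA κ Φ t p O.D O.DT.toDataN O.ori (gOf κ Φ t p O gv) (fOf κ Φ t p O fv)) w))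
    (hfoot₃ : ∀ k ≤ (Skelφ.kgCorrSchedY HKy.hn HKy.hv HKy.hlay (HKy.kgYVals_ok₁ Ny) (HKy.kgYVals_ok₂ Ny) (HKy.kgYVals_split Ny)).N, ∀ w ∈ graphBall G t Rπ, Skelφ.runX (φL κ Φ t p O.D O.DT.toDataN O.ori (gOf κ Φ t p O gv) (fOf κ Φ t p O fv)) c₂ (nL κ Φ t p O.merged (gOf κ Φ t p O gv) (fOf κ Φ t p O fv)) (hL κ Φ t p O.merged (gOf κ Φ t p O gv) (fOf κ Φ t p O fv)) 1 w ∈ (Skelφ.kgCorrSchedY HKy.hn HKy.hv HKy.hlay (HKy.kgYVals_ok₁ Ny) (HKy.kgYVals_ok₂ Ny) (HKy.kgYVals_split Ny)).region k → RootFootV (fcellsV κ Φ t p O.merged (gOf κ Φ t p O gv) (fOf κ Φ t p O fv) (cOf κ Φ t p O gv fv cv) (hOf κ Φ t p O gv fv hv)) (((1 : Fin 2), true) : MDir) ((fineOA κ Φ t p O.D O.DT.toDataN O.ori (gOf κ Φ t p O gv) (fOf κ Φ t p O fv)) w))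
    (hclear₃ : ∀ k ≤ (Skelφ.kgCorrSchedY HKy.hn HKy.hv HKy.hlay (HKy.kgYVals_ok₁ Ny) (HKy.kgYVals_ok₂ Ny) (HKy.kgYVals_split Ny)).N, ∀ w ∈ graphBall G t Rπ, Skelφ.runX (φL κ Φ t p O.D O.DT.toDataN O.ori (gOf κ Φ t p O gv) (fOf κ Φ t p O fv)) c₂ (nL κ Φ t p O.merged (gOf κ Φ t p O gv) (fOf κ Φ t p O fv)) (hL κ Φ t p O.merged (gOf κ Φ t p O gv) (fOf κ Φ t p O fv)) 1 w ∈ (Skelφ.kgCorrSchedY HKy.hn HKy.hv HKy.hlay (HKy.kgYVals_ok₁ Ny) (HKy.kgYVals_ok₂ Ny) (HKy.kgYVals_split Ny)).region k →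
      (KS.Rs t Dk mkP : ℤ) < rootFrame (φL κ Φ t p O.D O.DT.toDataN O.ori (gOf κ Φ t p O gv) (fOf κ Φ t p O fv)) t 1 w 0 ∨ (KS.Rs t Dk mkP : ℤ) < rootFrame (φL κ Φ t p O.D O.DT.toDataN O.ori (gOf κ Φ t p O gv) (fOf κ Φ t p O fv)) t 1 w 1 ∨ rootFrame (φL κ Φ t p O.D O.DT.toDataN O.ori (gOf κ Φ t p O gv) (fOf κ Φ t p O fv)) t 1 w 0 < -(KS.Rs t Dk mkP : ℤ) ∨ rootFrame (φL κ Φ t p O.D O.DT.toDataN O.ori (gOf κ Φ t p O gv) (fOf κ Φ t p O fv)) t 1 w 1 < -(KS.Rs t Dk mkP : ℤ))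
    (hx : ∀ w ∈ graphBall G t Rπ, rootFrame (φL κ Φ t p O.D O.DT.toDataN O.ori (gOf κ Φ t p O gv) (fOf κ Φ t p O fv)) t 1 w ∈ Finset.Icc B.core1Lo B.core1Hi → Skelφ.runX (φL κ Φ t p O.D O.DT.toDataN O.ori (gOf κ Φ t p O gv) (fOf κ Φ t p O fv)) c₁ (nL κ Φ t p O.merged (gOf κ Φ t p O gv) (fOf κ Φ t p O fv)) (hL κ Φ t p O.merged (gOf κ Φ t p O gv) (fOf κ Φ t p O fv)) 1 w ∈ ScheduleNP.core (Skelφ.kgCorrSched (HKx.kgVals_ok₁ Nx) (HKx.kgVals_ok₂ Nx) (HKx.kgVals_split Nx)) 0)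
    (hx₂ : ∀ w ∈ graphBall G t Rπ, Skelφ.runX (φL κ Φ t p O.D O.DT.toDataN O.ori (gOf κ Φ t p O gv) (fOf κ Φ t p O fv)) c₁ (nL κ Φ t p O.merged (gOf κ Φ t p O gv) (fOf κ Φ t p O fv)) (hL κ Φ t p O.merged (gOf κ Φ t p O gv) (fOf κ Φ t p O fv)) 1 w ∈ ScheduleNP.core (Skelφ.kgCorrSched (HKx.kgVals_ok₁ Nx) (HKx.kgVals_ok₂ Nx) (HKx.kgVals_split Nx)) ((Skelφ.kgCorrSched (HKx.kgVals_ok₁ Nx) (HKx.kgVals_ok₂ Nx) (HKx.kgVals_split Nx)).N + 1) → Skelφ.runX (φL κ Φ t p O.D O.DT.toDataN O.ori (gOf κ Φ t p O gv) (fOf κ Φ t p O fv)) c₂ (nL κ Φ t p O.merged (gOf κ Φ t p O gv) (fOf κ Φ t p O fv)) (hL κ Φ t p O.merged (gOf κ Φ t p O gv) (fOf κ Φ t p O fv)) 1 w ∈ ScheduleNP.core (Skelφ.kgCorrSchedY HKy.hn HKy.hv HKy.hlay (HKy.kgYVals_ok₁ Ny) (HKy.kgYVals_ok₂ Ny) (HKy.kgYVals_split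 Ny)) 0)
    (hlastf : ∀ w ∈ graphBall G t Rπ, Skelφ.runX (φL κ Φ t p O.D O.DT.toDataN O.ori (gOf κ Φ t p O gv) (fOf κ Φ t p O fv)) c₂ (nL κ Φ t p O.merged (gOf κ Φ t p O gv) (fOf κ Φ t p O fv)) (hL κ Φ t p O.merged (gOf κ Φ t p O gv) (fOf κ Φ t p O fv)) 1 w ∈ ScheduleNP.core (Skelφ.kgCorrSchedY HKy.hn HKy.hv HKy.hlay (HKy.kgYVals_ok₁ Ny) (HKy.kgYVals_ok₂ Ny) (HKy.kgYVals_split Ny)) ((Skelφ.kgCorrSchedY HKy.hn HKy.hv HKy.hlay (HKy.kgYVals_ok₁ Ny) (HKy.kgYVals_ok₂ Ny) (HKy.kgYVals_split Ny)).N + 1) → TargetFootV (fcellsV κ Φ t p O.merged (gOf κ Φ t p O gv) (fOf κ Φ t p O fv) (cOf κ Φ t p O gv fv cv) (hOf κ Φ t p O gv fv hv)) (bOf κ Φ t p O gv fv bv) (((1 : Fin 2), true) : MDir) ((fineOA κ Φ t p O.D O.DT.toDataN O.ori (gOf κ Φ t p O gv) (fOf κ Φ t p O fv)) w))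
    {φe : V → Site 2} {m R₁ : ℕ}
    (hDm : ∀ d ∈ ((((KSchA.mk (ΓQV κ Φ t p O gv fv Sv cv hv bv q) q κ.δ : KSchA V ℕ)).U0root (((1 : Fin 2), true) : MDir)).filter fun y => y ∈ graphBall G t Rπ) \ O.merged.Λ (hP.prox t) O.merged.k,
      ∀ d' ∈ ((((KSchA.mk (ΓQV κ Φ t p O gv fv Sv cv hv bv q) q κ.δ : KSchA V ℕ)).U0root (((1 : Fin 2), true) : MDir)).filter fun y => y ∈ graphBall G t Rπ) \ O.merged.Λ (hP.prox t) O.merged.k, φe d - φe d' ∈ box 2 m)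
    -- THE RIM-EXCESS DEVICE at the root (stmt SlotsS), at `κ.δr 0 / 2`, entrance depth `Rs + 1`, below both kits' rims
    (hR₁ : ∀ R'', R₁ ≤ R'' → ∀ (Rw : ℕ) (D' B' : Finset V), (∀ d ∈ D', d ∈ graphBall G t Rw) →
      (∀ d ∈ D', ∀ d' ∈ D', φe d - φe d' ∈ box 2 m) → B' ⊆ D' → (∀ a ∈ B', a ∈ graphBall G t (D + Skelφ.fatRadius Φ.frame hC O.merged.k + 1)) →
        (bondPercolation G q).real (Skel.excess G t R'' D' B') ≤ κ.δr 0 / 2)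
    (hR₁b : R₁ ≤ Rπ - KS0.r₀0N (KS.NQ Φ) t Dk mkP Rb) (hR₁r : R₁ ≤ Rπ - KS0.r₀0N (KS.NQ Φ) t Dk mkP (RL κ Φ t p O gv fv + D))
    -- THE LENGTH ROW (stmt `kgSchedN_le_LfQ`: `N_corridor + 1 ≤ LfQ`; the bridge is the `+1`)
    (hlen : (B.bridgeFrame hB).N + 1 + (Skelφ.kgCorrSched (HKx.kgVals_ok₁ Nx) (HKx.kgVals_ok₂ Nx) (HKx.kgVals_split Nx)).toFrame.N + 1 + (Skelφ.kgCorrSchedY HKy.hn HKy.hv HKy.hlay (HKy.kgYVals_ok₁ Ny) (HKy.kgYVals_ok₂ Ny) (HKy.kgYVals_split Ny)).toFrame.N ≤ Lf κ.K₀) :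
    ∃ n, n ≤ Lf κ.K₀ ∧ ∃ (c : V) (Rπ : ℕ) (W : Sym2 V → unitInterval) (s : Fin (n + 1) → KNLevels.TStep (winGraph G c Rπ))
      (T' : Fin (n + 1) → Finset V) (η' : ℝ),
      (∀ T : Finset V, (prodBernoulli W).real (⋃ t' ∈ T, openConn (ΓQV κ Φ t p O gv fv Sv cv hv bv q).root t') ≤
        (prodBernoulli (pinW (KNLevels.lattW G q) ↑((⟨ΓQV κ Φ t p O gv fv Sv cv hv bv q, q, κ.δ⟩ : KSchA V ℕ).U₀ G)
          ↑((⟨ΓQV κ Φ t p O gv fv Sv cv hv bv q, q, κ.δ⟩ : KSchA V ℕ).U₀ G))).real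
          (⋃ t' ∈ (↑T : Set V), openConnIn (↑((ΓQV κ Φ t p O gv fv Sv cv hv bv q).Q (ΓQV κ Φ t p O gv fv Sv cv hv bv q).a₀ 0 ∪
            (ΓQV κ Φ t p O gv fv Sv cv hv bv q).Ewv (ΓQV κ Φ t p O gv fv Sv cv hv bv q).a₀ 0 (((1 : Fin 2), true) : MDir)) : Set V)
            (ΓQV κ Φ t p O gv fv Sv cv hv bv q).root t')) ∧
      (∀ i : Fin (n + 1), (s i).L.o = (ΓQV κ Φ t p O gv fv Sv cv hv bv q).root) ∧
      (∀ i : Fin n, T' (Fin.castSucc i) ⊆ (s i.succ).L.X 0) ∧ (∀ i : Fin (n + 1), T' i ⊆ (s i).T) ∧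
      (∀ i : Fin (n + 1), (s i).KitsAtF W q Φ.Δ (κ.δr 0)) ∧ η' ≤ κ.δr 0 / 2 ∧
      (∀ i : Fin (n + 1), (prodBernoulli W).real (⋃ t' ∈ (s i).T \ T' i, openConn (ΓQV κ Φ t p O gv fv Sv cv hv bv q).root t') ≤ η') ∧
      1 - κ.δr 0 < (prodBernoulli W).real (s 0).L.reachB ∧
      T' (Fin.last n) ⊆ (ΓQV κ Φ t p O gv fv Sv cv hv bv q).M (ΓQV κ Φ t p O gv fv Sv cv hv bv q).a₀ ((0 : Site 2) + stepVec (((1 : Fin 2), true) : MDir)) := by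
  have hAt' := atQ3_of_atQ3V hAt
  -- facts at `AtQNQ`
  have hEq : EqNumL κ Φ t p O.merged (gOf κ Φ t p O gv) (fOf κ Φ t p O fv) := eqNumL_of_atQ hAt'
  obtain ⟨hn1, hℓ1⟩ := one_le_of_eqNumL κ Φ t p O.merged (gOf κ Φ t p O gv) (fOf κ Φ t p O fv) hEq
  have hκL := (clauseL_of_atQ hAt').2
  obtain ⟨-, hq1, hq2, -⟩ := factsNS_of_atQ hAt'
  have hδ0 : 0 < κ.δr 0 := (κ.hδr 0).1
  have hδ1 : κ.δr 0 ≤ 1 := (κ.hδr 0).2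
  have hkit : Neg.δkit κ Φ ≤ κ.δr 0 := Neg.δkit_le_δr κ Φ (n := 0) (by norm_num)
  have hlipφ := lip_φL κ Φ t p O.D O.DT.toDataN O.ori (gOf κ Φ t p O gv) (fOf κ Φ t p O fv)
  have hqφ := qStepsN_φL κ Φ t p O.D O.DT.toDataN O.ori (gOf κ Φ t p O gv) (fOf κ Φ t p O fv)
  -- the zone AT THE SEED LEVEL `k` ((R-42)): centred, its graph radii (`Rs` for the footprints, `fatRadius k` for the rim device)
  have hcz := hczK_of_atQPx hAt' hP hDk
  have hZρk := hZρK_of_atQPx hAt' hP t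
  -- the fine map: 1-Lipschitz, weak steps, root at the origin
  have hlipψ := lip_fineA_at κ Φ t p O.merged (gOf κ Φ t p O gv) (fOf κ Φ t p O fv) hlipφ hEq
  have hwsψ := weakSteps_fineA_at κ Φ t p O.merged (gOf κ Φ t p O gv) (fOf κ Φ t p O fv) hqφ hEq
  have hψ0 := fineA_base_at κ Φ t p O.merged (gOf κ Φ t p O gv) (fOf κ Φ t p O fv) (φL κ Φ t p O.D O.DT.toDataN O.ori (gOf κ Φ t p O gv) (fOf κ Φ t p O fv)) hEq
  -- the short region and the seed rows: depth `Rs`, footprint, along-coordinate bound `kb := Rs`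
  -- the short region UNDER PROXIES: the kit parallelogram about `c` at radius `RK mk + D` («SkelFrmFromBChoiceZoneKPx» prism form), inside `B(c, Rs(Dk, mkP))`
  -- by `hRK`, of cardinality `≤ cUA(Dk, mkP)`
  have hRg : ∀ c, ∀ u ∈ Skelφ.pgramPrismFin G (KS.φK Φ t O.D O.DT.toDataN O.ori mk) c (KS.nKit O.merged mk) (KS.hKit t O.merged mk) (3 * KS.ℓKit t O.merged mk)
      (KS.RK t O.merged mk + D), u ∈ graphBall G c (KS.Rs t Dk mkP) := fun c u hu =>
    graphBall_mono G c (hRK.trans (KS.RK_le_Rs t Dk mkP).1)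
      (Skelφ.cylBall_subset_prism G (KS.φK Φ t O.D O.DT.toDataN O.ori mk) c _ _ ((Skelφ.mem_pgramPrismFin G (KS.φK Φ t O.D O.DT.toDataN O.ori mk)).1 hu).1).1
  have hRgcard : ∀ c, (Skelφ.pgramPrismFin G (KS.φK Φ t O.D O.DT.toDataN O.ori mk) c (KS.nKit O.merged mk) (KS.hKit t O.merged mk) (3 * KS.ℓKit t O.merged mk)
      (KS.RK t O.merged mk + D)).card ≤ KS.cUA Φ t Dk mkP := fun c => by
    classical
    refine le_trans (Finset.card_le_card fun v hv => ?_) ((Skelφ.card_cylBallFin_le (φ := KS.φK Φ t O.D O.DT.toDataN O.ori mk) Φ.degree_le c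
      (Skelφ.pgScale (KS.nKit O.merged mk) (KS.hKit t O.merged mk) (3 * KS.ℓKit t O.merged mk)) (KS.RK t O.merged mk + D)).trans
      (Nat.pow_le_pow_right (Nat.succ_pos _) hRK))
    rw [Skelφ.mem_cylBallFin]
    exact ((Skelφ.mem_pgramPrismFin G (KS.φK Φ t O.D O.DT.toDataN O.ori mk)).1 hv).1
  have hΛRgK : ∀ c, O.merged.Λ (hP.prox c) O.merged.k ⊆ Skelφ.pgramPrismFin G (KS.φK Φ t O.D O.DT.toDataN O.ori mk) c (KS.nKit O.merged mk) (KS.hKit t O.merged mk) (3 * KS.ℓKit t O.merged mk)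
      (KS.RK t O.merged mk + D) := fun c a ha =>
    (Skelφ.mem_pgramPrismFin G (KS.φK Φ t O.D O.DT.toDataN O.ori mk)).2 (hΛRgK_of_atQPx mk hAt' hP hnK c (Finset.mem_coe.2 ha))
  have hZρ : ∀ u ∈ O.merged.Λ (hP.prox t) O.merged.k, u ∈ graphBall G t (KS.Rs t Dk mkP) := fun u hu => hRg t u (hΛRgK t hu)
  have hψabs : ∀ {n : ℕ}, ∀ u ∈ graphBall G t n, ∀ i, |fineA κ Φ t p O.merged (gOf κ Φ t p O gv) (fOf κ Φ t p O fv) (φL κ Φ t p O.D O.DT.toDataN O.ori (gOf κ Φ t p O gv) (fOf κ Φ t p O fv)) u i| ≤ (n : ℤ) := by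
    intro n u hu i
    have h := Skelφ.abs_sub_le_of_mem_graphBall hlipψ hu i
    rwa [hψ0, Pi.zero_apply, sub_zero] at h
  have hZfoot : ∀ a ∈ O.merged.Λ (hP.prox t) O.merged.k,
      -(5 * (((fcellsV κ Φ t p O.merged (gOf κ Φ t p O gv) (fOf κ Φ t p O fv) (cOf κ Φ t p O gv fv cv) (hOf κ Φ t p O gv fv hv))).r (((1 : Fin 2), true) : MDir).1 : ℤ)) + 1 ≤ sgOf (((1 : Fin 2), true) : MDir) * fineA κ Φ t p O.merged (gOf κ Φ t p O gv) (fOf κ Φ t p O fv) (φL κ Φ t p O.D O.DT.toDataN O.ori (gOf κ Φ t p O gv) (fOf κ Φ t p O fv)) a (((1 : Fin 2), true) : MDir).1 ∧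
      sgOf (((1 : Fin 2), true) : MDir) * fineA κ Φ t p O.merged (gOf κ Φ t p O gv) (fOf κ Φ t p O fv) (φL κ Φ t p O.D O.DT.toDataN O.ori (gOf κ Φ t p O gv) (fOf κ Φ t p O fv)) a (((1 : Fin 2), true) : MDir).1 ≤ 5 * (((fcellsV κ Φ t p O.merged (gOf κ Φ t p O gv) (fOf κ Φ t p O fv) (cOf κ Φ t p O gv fv cv) (hOf κ Φ t p O gv fv hv))).r (((1 : Fin 2), true) : MDir).1 : ℤ) ∧
      |fineA κ Φ t p O.merged (gOf κ Φ t p O gv) (fOf κ Φ t p O fv) (φL κ Φ t p O.D O.DT.toDataN O.ori (gOf κ Φ t p O gv) (fOf κ Φ t p O fv)) a (oth (((1 : Fin 2), true) : MDir).1)| ≤ 5 * (((fcellsV κ Φ t p O.merged (gOf κ Φ t p O gv) (fOf κ Φ t p O fv) (cOf κ Φ t p O gv fv cv) (hOf κ Φ t p O gv fv hv))).r (oth (((1 : Fin 2), true) : MDir).1) : ℤ) - 1 :=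
    fun a ha => Skelφ.seedFootT_of_abs_le (fcellsV κ Φ t p O.merged (gOf κ Φ t p O gv) (fOf κ Φ t p O fv) (cOf κ Φ t p O gv fv cv) (hOf κ Φ t p O gv fv hv)).toPCells2T (((1 : Fin 2), true) : MDir) (hψabs a (hZρ a ha)) hRs5
  have hZk : ∀ a ∈ O.merged.Λ (hP.prox t) O.merged.k, |rootFrame (φL κ Φ t p O.D O.DT.toDataN O.ori (gOf κ Φ t p O gv) (fOf κ Φ t p O fv)) t 1 a 0| ≤ (KS.Rs t Dk mkP : ℤ) := fun a ha => by
    have h := Skelφ.abs_sub_le_of_mem_graphBall hlipφ (hZρ a ha) 0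
    have hrf : rootFrame (φL κ Φ t p O.D O.DT.toDataN O.ori (gOf κ Φ t p O gv) (fOf κ Φ t p O fv)) t 1 a 0 = (φL κ Φ t p O.D O.DT.toDataN O.ori (gOf κ Φ t p O gv) (fOf κ Φ t p O fv)) a 0 - (φL κ Φ t p O.D O.DT.toDataN O.ori (gOf κ Φ t p O gv) (fOf κ Φ t p O fv)) t 0 := by
      show (if (0 : Fin 2) = 0 then (1 : ℤ) * ((φL κ Φ t p O.D O.DT.toDataN O.ori (gOf κ Φ t p O gv) (fOf κ Φ t p O fv)) a 0 - (φL κ Φ t p O.D O.DT.toDataN O.ori (gOf κ Φ t p O gv) (fOf κ Φ t p O fv)) t 0) else (φL κ Φ t p O.D O.DT.toDataN O.ori (gOf κ Φ t p O gv) (fOf κ Φ t p O fv)) a 1 - (φL κ Φ t p O.D O.DT.toDataN O.ori (gOf κ Φ t p O gv) (fOf κ Φ t p O fv)) t 1) = _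
      rw [if_pos rfl, one_mul]
    rw [hrf]; exact h
  have hZk₁ : ∀ a ∈ O.merged.Λ (hP.prox t) O.merged.k, |rootFrame (φL κ Φ t p O.D O.DT.toDataN O.ori (gOf κ Φ t p O gv) (fOf κ Φ t p O fv)) t 1 a 1| ≤ (KS.Rs t Dk mkP : ℤ) := fun a ha => by
    have h := Skelφ.abs_sub_le_of_mem_graphBall hlipφ (hZρ a ha) 1
    have hrf : rootFrame (φL κ Φ t p O.D O.DT.toDataN O.ori (gOf κ Φ t p O gv) (fOf κ Φ t p O fv)) t 1 a 1 = (φL κ Φ t p O.D O.DT.toDataN O.ori (gOf κ Φ t p O gv) (fOf κ Φ t p O fv)) a 1 - (φL κ Φ t p O.D O.DT.toDataN O.ori (gOf κ Φ t p O gv) (fOf κ Φ t p O fv)) t 1 := by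
      show (if (1 : Fin 2) = 0 then (1 : ℤ) * ((φL κ Φ t p O.D O.DT.toDataN O.ori (gOf κ Φ t p O gv) (fOf κ Φ t p O fv)) a 0 - (φL κ Φ t p O.D O.DT.toDataN O.ori (gOf κ Φ t p O gv) (fOf κ Φ t p O fv)) t 0) else (φL κ Φ t p O.D O.DT.toDataN O.ori (gOf κ Φ t p O gv) (fOf κ Φ t p O fv)) a 1 - (φL κ Φ t p O.D O.DT.toDataN O.ori (gOf κ Φ t p O gv) (fOf κ Φ t p O fv)) t 1) = _
      rw [if_neg (by decide)]
    rw [hrf]; exact h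
  -- the two kits at the kit index `mk`: constants, sizes, thresholds, reach
  obtain ⟨-, hdD, hDρ, hKCmax, hT⟩ := KS0.kit0N_ok (KS.NQ Φ) t Dk mkP ((Mu Dk + 1 : ℕ) * (Skelφ.shearUnit (nL κ Φ t p O.merged (gOf κ Φ t p O gv) (fOf κ Φ t p O fv)) (hL κ Φ t p O.merged (gOf κ Φ t p O gv) (fOf κ Φ t p O fv)) : ℤ) + 1)
    (KS0.r₀0N (KS.NQ Φ) t Dk mkP (RL κ Φ t p O gv fv + D)) (kq := 10) le_rfl
  have hPN := (KS0.kit0N_costs Φ t Dk mkP ((Mu Dk + 1 : ℕ) * (Skelφ.shearUnit (nL κ Φ t p O.merged (gOf κ Φ t p O gv) (fOf κ Φ t p O fv)) (hL κ Φ t p O.merged (gOf κ Φ t p O gv) (fOf κ Φ t p O fv)) : ℤ) + 1)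
    (KS0.r₀0N (KS.NQ Φ) t Dk mkP (RL κ Φ t p O gv fv + D)) (kq := 10) le_rfl).1
  obtain ⟨hrs, hcS⟩ := KS0.kit0N_sizes Φ (KS.NQ Φ) t Dk mkP ((Mu Dk + 1 : ℕ) * (Skelφ.shearUnit (nL κ Φ t p O.merged (gOf κ Φ t p O gv) (fOf κ Φ t p O fv)) (hL κ Φ t p O.merged (gOf κ Φ t p O gv) (fOf κ Φ t p O fv)) : ℤ) + 1) (KS0.r₀0N (KS.NQ Φ) t Dk mkP (RL κ Φ t p O gv fv + D))
  obtain ⟨hr₀, -⟩ := KS0.hr₀_kit0N (KS.one_le_NQ Φ) t Dk mkP ((Mu Dk + 1 : ℕ) * (Skelφ.shearUnit (nL κ Φ t p O.merged (gOf κ Φ t p O gv) (fOf κ Φ t p O fv)) (hL κ Φ t p O.merged (gOf κ Φ t p O gv) (fOf κ Φ t p O fv)) : ℤ) + 1) (KS0.r₀0N_ge (KS.NQ Φ) t Dk mkP (RL κ Φ t p O gv fv + D)).1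
  have hreach := KS0.hreach_kit0N (KS.NQ Φ) t Dk mkP ((Mu Dk + 1 : ℕ) * (Skelφ.shearUnit (nL κ Φ t p O.merged (gOf κ Φ t p O gv) (fOf κ Φ t p O fv)) (hL κ Φ t p O.merged (gOf κ Φ t p O gv) (fOf κ Φ t p O fv)) : ℤ) + 1) (KS0.r₀0N_ge (KS.NQ Φ) t Dk mkP (RL κ Φ t p O gv fv + D)).2
  obtain ⟨-, hdDb, hDρb, hKCmaxb, hTb⟩ := KS0.kit0N_ok (KS.NQ Φ) t Dk mkP ((Mu Dk : ℤ) + 2) (KS0.r₀0N (KS.NQ Φ) t Dk mkP Rb) (kq := 0) (by norm_num)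
  have hPNb := (KS0.kit0N_costs Φ t Dk mkP ((Mu Dk : ℤ) + 2) (KS0.r₀0N (KS.NQ Φ) t Dk mkP Rb) (kq := 0) (by norm_num)).2.2.1
  obtain ⟨hrsb, hcSb⟩ := KS0.kit0N_sizes Φ (KS.NQ Φ) t Dk mkP ((Mu Dk : ℤ) + 2) (KS0.r₀0N (KS.NQ Φ) t Dk mkP Rb)
  obtain ⟨hr₀b, -⟩ := KS0.hr₀_kit0N (KS.one_le_NQ Φ) t Dk mkP ((Mu Dk : ℤ) + 2) (KS0.r₀0N_ge (KS.NQ Φ) t Dk mkP Rb).1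
  have hreachb := KS0.hreach_kit0N (KS.NQ Φ) t Dk mkP ((Mu Dk : ℤ) + 2) (KS0.r₀0N_ge (KS.NQ Φ) t Dk mkP Rb).2
  have hRLπ : (RL κ Φ t p O gv fv + D) ≤ Rπ := le_trans (Nat.le_add_right _ _) ((KS0.r₀0N_ge (KS.NQ Φ) t Dk mkP (RL κ Φ t p O gv fv + D)).2.trans hr₀R)
  have hRbπ : Rb ≤ Rπ := le_trans (Nat.le_add_right _ _) ((KS0.r₀0N_ge (KS.NQ Φ) t Dk mkP Rb).2.trans hr₀bR)
  -- the counts at the root accuracy, the levels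
  obtain ⟨hk, hcount⟩ := KS0.counts_atqN_root κ Φ (KS.NQ Φ) t p Dk mkP hp0 hp1 hq1 hq2
  have hNk := KS0.hNk0N_at κ Φ (KS.NQ Φ) t p Dk mkP hp0 hp1
  have hreach0 : ∀ (A : ℤ) (r₀ : ℕ), KS0.j₁0N κ Φ (KS.NQ Φ) t p Dk mkP +
      ((KS0.kit0N (KS.NQ Φ) t Dk mkP A r₀).N * (tanOff (KS0.kit0N (KS.NQ Φ) t Dk mkP A r₀).ℓs (KS0.kit0N (KS.NQ Φ) t Dk mkP A r₀).M + 1) +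
        (KS0.kit0N (KS.NQ Φ) t Dk mkP A r₀).N * (KS0.kit0N (KS.NQ Φ) t Dk mkP A r₀).d + (KS0.kit0N (KS.NQ Φ) t Dk mkP A r₀).N * KS.KCmax t Dk mkP) ≤ KS0.R'0N κ Φ (KS.NQ Φ) t p Dk mkP := by
    intro A r₀
    rw [KS0.tanOff_kit0N]
    simp only [KS0.kit0N]
    have h := (KS0.R'0N_eq κ Φ (KS.NQ Φ) t p Dk mkP).1
    unfold KS0.reach0N at h
    omega
  -- the bridge level-width rows from `B₀lo ≤ B₀hi`, `j ≥ j₀0 = T0 = tanOff`, and the kit constants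
  have hT0 : tanOff (KS0.kit0N (KS.NQ Φ) t Dk mkP ((Mu Dk : ℤ) + 2) (KS0.r₀0N (KS.NQ Φ) t Dk mkP Rb)).ℓs (KS0.kit0N (KS.NQ Φ) t Dk mkP ((Mu Dk : ℤ) + 2) (KS0.r₀0N (KS.NQ Φ) t Dk mkP Rb)).M = KS0.j₀0N (KS.NQ Φ) t Dk mkP := KS0.tanOff_kit0N (KS.NQ Φ) t Dk mkP _ _
  have hwideb : ∀ j, KS0.j₀0N (KS.NQ Φ) t Dk mkP ≤ j → j ≤ KS0.j₁0N κ Φ (KS.NQ Φ) t p Dk mkP → ∀ i,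
      (B.B₀lo - (j : Site 2)) i + 2 * tanOff (KS0.kit0N (KS.NQ Φ) t Dk mkP ((Mu Dk : ℤ) + 2) (KS0.r₀0N (KS.NQ Φ) t Dk mkP Rb)).ℓs (KS0.kit0N (KS.NQ Φ) t Dk mkP ((Mu Dk : ℤ) + 2) (KS0.r₀0N (KS.NQ Φ) t Dk mkP Rb)).M ≤ (B.B₀hi + (j : Site 2)) i :=
    fun j hj0 _ i => Skelφ.icc_level_room hB0 hj0 (by rw [hT0]) i
  have hdwb : ∀ j, KS0.j₀0N (KS.NQ Φ) t Dk mkP ≤ j → j ≤ KS0.j₁0N κ Φ (KS.NQ Φ) t p Dk mkP → ∀ i,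
      (B.B₀lo - (j : Site 2)) i + ((KS0.kit0N (KS.NQ Φ) t Dk mkP ((Mu Dk : ℤ) + 2) (KS0.r₀0N (KS.NQ Φ) t Dk mkP Rb)).d + 2 : ℕ) ≤ (B.B₀hi + (j : Site 2)) i :=
    fun j hj0 _ i => Skelφ.icc_level_room hB0 hj0 (by have h := hTb; rw [hT0] at h; push_cast at h ⊢; omega) i
  have hDwb : ∀ j, KS0.j₀0N (KS.NQ Φ) t Dk mkP ≤ j → j ≤ KS0.j₁0N κ Φ (KS.NQ Φ) t p Dk mkP → ∀ i,
      (B.B₀lo - (j : Site 2)) i + ((Skelφ.shellD (KS0.kit0N (KS.NQ Φ) t Dk mkP ((Mu Dk : ℤ) + 2) (KS0.r₀0N (KS.NQ Φ) t Dk mkP Rb)) + 1 + (KS0.kit0N (KS.NQ Φ) t Dk mkP ((Mu Dk : ℤ) + 2) (KS0.r₀0N (KS.NQ Φ) t Dk mkP Rb)).d + (KS0.kit0N (KS.NQ Φ) t Dk mkP ((Mu Dk : ℤ) + 2) (KS0.r₀0N (KS.NQ Φ) t Dk mkP Rb)).N * KS.KCmax t Dk mkP + KS.Rs t Dk mkP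 : ℕ) : ℤ) ≤ (B.B₀hi + (j : Site 2)) i :=
    fun j hj0 _ i => Skelφ.icc_level_room hB0 hj0 (by have h := hTb; rw [hT0] at h; push_cast at h ⊢; omega) i
  -- the bridge's true target window is nonempty: a frame vertex over the corner `core1Lo`, within the window by `hc1R`
  have hTne₁ : (Skelφ.Win G (rootFrame (φL κ Φ t p O.D O.DT.toDataN O.ori (gOf κ Φ t p O gv) (fOf κ Φ t p O fv)) t 1) t (Finset.Icc B.core1Lo B.core1Hi) Rπ).Nonempty := by
    obtain ⟨g, hg, hgy⟩ := Skelφ.QStepsN.exists_mem_graphBall_eq hqφ t ((φL κ Φ t p O.D O.DT.toDataN O.ori (gOf κ Φ t p O gv) (fOf κ Φ t p O fv)) t + B.core1Lo)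
    have h0 : ((φL κ Φ t p O.D O.DT.toDataN O.ori (gOf κ Φ t p O gv) (fOf κ Φ t p O fv)) t + B.core1Lo) 0 - (φL κ Φ t p O.D O.DT.toDataN O.ori (gOf κ Φ t p O gv) (fOf κ Φ t p O fv)) t 0 = B.core1Lo 0 := by simp
    have h1' : ((φL κ Φ t p O.D O.DT.toDataN O.ori (gOf κ Φ t p O gv) (fOf κ Φ t p O fv)) t + B.core1Lo) 1 - (φL κ Φ t p O.D O.DT.toDataN O.ori (gOf κ Φ t p O gv) (fOf κ Φ t p O fv)) t 1 = B.core1Lo 1 := by simp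
    rw [h0, h1'] at hg
    refine ⟨g, (Skelφ.mem_Win (G := G) (φ := rootFrame (φL κ Φ t p O.D O.DT.toDataN O.ori (gOf κ Φ t p O gv) (fOf κ Φ t p O fv)) t 1)).2 ⟨graphBall_mono G t hc1R hg, ?_⟩⟩
    have hg0 : (φL κ Φ t p O.D O.DT.toDataN O.ori (gOf κ Φ t p O gv) (fOf κ Φ t p O fv)) g 0 = (φL κ Φ t p O.D O.DT.toDataN O.ori (gOf κ Φ t p O gv) (fOf κ Φ t p O fv)) t 0 + B.core1Lo 0 := by have := congrFun hgy 0; simpa using this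
    have hg1 : (φL κ Φ t p O.D O.DT.toDataN O.ori (gOf κ Φ t p O gv) (fOf κ Φ t p O fv)) g 1 = (φL κ Φ t p O.D O.DT.toDataN O.ori (gOf κ Φ t p O gv) (fOf κ Φ t p O fv)) t 1 + B.core1Lo 1 := by have := congrFun hgy 1; simpa using this
    have hrf : rootFrame (φL κ Φ t p O.D O.DT.toDataN O.ori (gOf κ Φ t p O gv) (fOf κ Φ t p O fv)) t 1 g = B.core1Lo := by
      funext i
      fin_cases i
      · show (if (0 : Fin 2) = 0 then (1 : ℤ) * ((φL κ Φ t p O.D O.DT.toDataN O.ori (gOf κ Φ t p O gv) (fOf κ Φ t p O fv)) g 0 - (φL κ Φ t p O.D O.DT.toDataN O.ori (gOf κ Φ t p O gv) (fOf κ Φ t p O fv)) t 0) else (φL κ Φ t p O.D O.DT.toDataN O.ori (gOf κ Φ t p O gv) (fOf κ Φ t p O fv)) g 1 - (φL κ Φ t p O.D O.DT.toDataN O.ori (gOf κ Φ t p O gv) (fOf κ Φ t p O fv)) t 1) = _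
        rw [if_pos rfl, one_mul, hg0]; simp
      · show (if (1 : Fin 2) = 0 then (1 : ℤ) * ((φL κ Φ t p O.D O.DT.toDataN O.ori (gOf κ Φ t p O gv) (fOf κ Φ t p O fv)) g 0 - (φL κ Φ t p O.D O.DT.toDataN O.ori (gOf κ Φ t p O gv) (fOf κ Φ t p O fv)) t 0) else (φL κ Φ t p O.D O.DT.toDataN O.ori (gOf κ Φ t p O gv) (fOf κ Φ t p O fv)) g 1 - (φL κ Φ t p O.D O.DT.toDataN O.ori (gOf κ Φ t p O gv) (fOf κ Φ t p O fv)) t 1) = _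
        rw [if_neg (by decide), hg1]; simp
    rw [hrf]; exact Finset.mem_Icc.2 ⟨le_rfl, hc1⟩
  -- the hop: the root's own long side half (`τ = 1`), its prism inside the window with root-world footprints, its target inside the bridge box
  have hlink : 1 - κ.δr 0 < (bondPercolation G q).real (linkIn (↑(Skelφ.pgramPrismFin G (φL κ Φ t p O.D O.DT.toDataN O.ori (gOf κ Φ t p O gv) (fOf κ Φ t p O fv)) t (nL κ Φ t p O.merged (gOf κ Φ t p O gv) (fOf κ Φ t p O fv)) (hL κ Φ t p O.merged (gOf κ Φ t p O gv) (fOf κ Φ t p O fv)) (3 * (ℓL κ Φ t p O.merged (gOf κ Φ t p O gv) (fOf κ Φ t p O fv))) (RL κ Φ t p O gv fv + D)) : Set V)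
      (O.merged.Λ (hP.prox t) O.merged.k) (pgSideHalfW G (φL κ Φ t p O.D O.DT.toDataN O.ori (gOf κ Φ t p O gv) (fOf κ Φ t p O fv)) t (nL κ Φ t p O.merged (gOf κ Φ t p O gv) (fOf κ Φ t p O fv)) (hL κ Φ t p O.merged (gOf κ Φ t p O gv) (fOf κ Φ t p O fv)) (ℓL κ Φ t p O.merged (gOf κ Φ t p O gv) (fOf κ Φ t p O fv)) (RL κ Φ t p O gv fv + D) 1 (1 * 1))) := by
    have h := hlongK_of_atQ3Px hAt' hP hkit hnL t 1 (Or.inl rfl)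
    have hcube : κ.δr 0 ^ 3 ≤ κ.δr 0 := pow_le_of_le_one hδ0.le hδ1 (by norm_num)
    rw [Skelφ.StepI.coe_pgramPrismFin]
    exact lt_of_le_of_lt (sub_le_sub_left hcube 1) h
  have hQπ : ∀ w ∈ Skelφ.pgramPrismFin G (φL κ Φ t p O.D O.DT.toDataN O.ori (gOf κ Φ t p O gv) (fOf κ Φ t p O fv)) t (nL κ Φ t p O.merged (gOf κ Φ t p O gv) (fOf κ Φ t p O fv)) (hL κ Φ t p O.merged (gOf κ Φ t p O gv) (fOf κ Φ t p O fv)) (3 * (ℓL κ Φ t p O.merged (gOf κ Φ t p O gv) (fOf κ Φ t p O fv))) (RL κ Φ t p O gv fv + D), w ∈ graphBall G t Rπ := fun w hw =>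
    graphBall_mono G t hRLπ (Skelφ.pgramPrism_subset_graphBall (G := G) (φ := (φL κ Φ t p O.D O.DT.toDataN O.ori (gOf κ Φ t p O gv) (fOf κ Φ t p O fv))) t _ _ _ _ ((Skelφ.mem_pgramPrismFin G (φL κ Φ t p O.D O.DT.toDataN O.ori (gOf κ Φ t p O gv) (fOf κ Φ t p O fv))).1 hw))
  have hQfoot : ∀ w ∈ Skelφ.pgramPrismFin G (φL κ Φ t p O.D O.DT.toDataN O.ori (gOf κ Φ t p O gv) (fOf κ Φ t p O fv)) t (nL κ Φ t p O.merged (gOf κ Φ t p O gv) (fOf κ Φ t p O fv)) (hL κ Φ t p O.merged (gOf κ Φ t p O gv) (fOf κ Φ t p O fv)) (3 * (ℓL κ Φ t p O.merged (gOf κ Φ t p O gv) (fOf κ Φ t p O fv))) (RL κ Φ t p O gv fv + D), RootFootV (fcellsV κ Φ t p O.merged (gOf κ Φ t p O gv) (fOf κ Φ t p O fv) (cOf κ Φ t p O gv fv cv) (hOf κ Φ t p O gv fv hv)) (((1 : Fin 2), true) : MDir) (fineA κ Φ t p O.merged (gOf κ Φ t p O gv) (fOf κ Φ t p O fv) (φL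 κ Φ t p O.D O.DT.toDataN O.ori (gOf κ Φ t p O gv) (fOf κ Φ t p O fv)) w) :=
    fun w hw => Skelφ.rootFootT_of_abs_le₂ (fcellsV κ Φ t p O.merged (gOf κ Φ t p O gv) (fOf κ Φ t p O fv) (cOf κ Φ t p O gv fv cv) (hOf κ Φ t p O gv fv hv)).toPCells2T (((1 : Fin 2), true) : MDir) (hkR w hw).2 (hkR w hw).1 hfR.1 hfR.2
  have hT₀ : ∀ w ∈ pgSideHalfW G (φL κ Φ t p O.D O.DT.toDataN O.ori (gOf κ Φ t p O gv) (fOf κ Φ t p O fv)) t (nL κ Φ t p O.merged (gOf κ Φ t p O gv) (fOf κ Φ t p O fv)) (hL κ Φ t p O.merged (gOf κ Φ t p O gv) (fOf κ Φ t p O fv)) (ℓL κ Φ t p O.merged (gOf κ Φ t p O gv) (fOf κ Φ t p O fv)) (RL κ Φ t p O gv fv + D) 1 (1 * 1), w ∈ graphBall G t Rπ ∧ rootFrame (φL κ Φ t p O.D O.DT.toDataN O.ori (gOf κ Φ t p O gv) (fOf κ Φ t p O fv)) t 1 w ∈ Finset.Icc B.B₀lo B.B₀hi :=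
    fun w hw => ⟨graphBall_mono G t hRLπ (Skelφ.pgramPrism_subset_graphBall (G := G) (φ := (φL κ Φ t p O.D O.DT.toDataN O.ori (gOf κ Φ t p O gv) (fOf κ Φ t p O fv))) t _ _ _ _ (Skelφ.coe_pgSideHalfW_subset _ _ _ _ _ _ _ hw)),
      hhopB w hw⟩
  -- the prefix's regions clear the seed in x ((R-F2′): `hX₁` through p5-g16's sharp `kgCorrSched_region_fst_lower`)
  have hclear₂ : ∀ k ≤ (Skelφ.kgCorrSched (HKx.kgVals_ok₁ Nx) (HKx.kgVals_ok₂ Nx) (HKx.kgVals_split Nx)).N, ∀ w ∈ graphBall G t Rπ, Skelφ.runX (φL κ Φ t p O.D O.DT.toDataN O.ori (gOf κ Φ t p O gv) (fOf κ Φ t p O fv)) c₁ (nL κ Φ t p O.merged (gOf κ Φ t p O gv) (fOf κ Φ t p O fv)) (hL κ Φ t p O.merged (gOf κ Φ t p O gv) (fOf κ Φ t p O fv)) 1 w ∈ (Skelφ.kgCorrSched (HKx.kgVals_ok₁ Nx) (HKx.kgVals_ok₂ Nx) (HKx.kgVals_split Nx)).region k →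
      (KS.Rs t Dk mkP : ℤ) < rootFrame (φL κ Φ t p O.D O.DT.toDataN O.ori (gOf κ Φ t p O gv) (fOf κ Φ t p O fv)) t 1 w 0 ∨ (KS.Rs t Dk mkP : ℤ) < rootFrame (φL κ Φ t p O.D O.DT.toDataN O.ori (gOf κ Φ t p O gv) (fOf κ Φ t p O fv)) t 1 w 1 ∨
        rootFrame (φL κ Φ t p O.D O.DT.toDataN O.ori (gOf κ Φ t p O gv) (fOf κ Φ t p O fv)) t 1 w 0 < -(KS.Rs t Dk mkP : ℤ) ∨ rootFrame (φL κ Φ t p O.D O.DT.toDataN O.ori (gOf κ Φ t p O gv) (fOf κ Φ t p O fv)) t 1 w 1 < -(KS.Rs t Dk mkP : ℤ) := by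
    intro k hk w _ hw
    have h0 := Skelφ.kgCorrSched_region_fst_lower (HKx.kgVals_ok₁ Nx) (HKx.kgVals_ok₂ Nx) (HKx.kgVals_split Nx) hnR hrow hk hw
    rw [Skelφ.runX_zero, Skelφ.relCoord_apply, one_mul] at h0
    have hrf : rootFrame (φL κ Φ t p O.D O.DT.toDataN O.ori (gOf κ Φ t p O gv) (fOf κ Φ t p O fv)) t 1 w 0 = (φL κ Φ t p O.D O.DT.toDataN O.ori (gOf κ Φ t p O gv) (fOf κ Φ t p O fv)) w 0 - (φL κ Φ t p O.D O.DT.toDataN O.ori (gOf κ Φ t p O gv) (fOf κ Φ t p O fv)) t 0 := by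
      show (if (0 : Fin 2) = 0 then (1 : ℤ) * ((φL κ Φ t p O.D O.DT.toDataN O.ori (gOf κ Φ t p O gv) (fOf κ Φ t p O fv)) w 0 - (φL κ Φ t p O.D O.DT.toDataN O.ori (gOf κ Φ t p O gv) (fOf κ Φ t p O fv)) t 0) else (φL κ Φ t p O.D O.DT.toDataN O.ori (gOf κ Φ t p O gv) (fOf κ Φ t p O fv)) w 1 - (φL κ Φ t p O.D O.DT.toDataN O.ori (gOf κ Φ t p O gv) (fOf κ Φ t p O fv)) t 1) = _
      rw [if_pos rfl, one_mul]
    left; rw [hrf]; linarith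
  -- the two depth rows over the prisms from the closed prism boxes (p5-g16 KGBoxes)
  have hRdepth : ∀ z ∈ (Skelφ.kgCorrSched (HKx.kgVals_ok₁ Nx) (HKx.kgVals_ok₂ Nx) (HKx.kgVals_split Nx)).prism, D₀ + Φ.M * (10 + 3) * ((z 0).natAbs + (z 1).natAbs) ≤ Rπ := by
    intro z hz
    have h := Skelφ.natAbs_le_of_mem_kgCorrSched_prism (HKx.kgVals_ok₁ Nx) (HKx.kgVals_ok₂ Nx) (HKx.kgVals_split Nx) hz
    have h2 : (Φ.M : ℤ) * ((10 : ℤ) + 3) * (((z 0).natAbs : ℤ) + (z 1).natAbs) ≤ (Φ.M : ℤ) * ((10 : ℤ) + 3) * _ := mul_le_mul_of_nonneg_left h (by positivity)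
    have : (D₀ : ℤ) + Φ.M * (10 + 3) * (((z 0).natAbs : ℤ) + (z 1).natAbs) ≤ Rπ := by linarith
    exact_mod_cast this
  have hRdepth₃ : ∀ z ∈ (Skelφ.kgCorrSchedY HKy.hn HKy.hv HKy.hlay (HKy.kgYVals_ok₁ Ny) (HKy.kgYVals_ok₂ Ny) (HKy.kgYVals_split Ny)).prism, D₀' + Φ.M * (10 + 3) * ((z 0).natAbs + (z 1).natAbs) ≤ Rπ := by
    intro z hz
    have h := Skelφ.natAbs_le_of_mem_kgCorrSchedY_prism HKy.hn HKy.hv HKy.hlay (HKy.kgYVals_ok₁ Ny) (HKy.kgYVals_ok₂ Ny) (HKy.kgYVals_split Ny) hz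
    have h2 : (Φ.M : ℤ) * ((10 : ℤ) + 3) * (((z 0).natAbs : ℤ) + (z 1).natAbs) ≤ (Φ.M : ℤ) * ((10 : ℤ) + 3) * _ := mul_le_mul_of_nonneg_left h (by positivity)
    have : (D₀' : ℤ) + Φ.M * (10 + 3) * (((z 0).natAbs : ℤ) + (z 1).natAbs) ≤ Rπ := by linarith
    exact_mod_cast this
  -- assemble
  refine ⟨(B.bridgeFrame hB).N + 1 + (Skelφ.kgCorrSched (HKx.kgVals_ok₁ Nx) (HKx.kgVals_ok₂ Nx) (HKx.kgVals_split Nx)).toFrame.N + 1 + (Skelφ.kgCorrSchedY HKy.hn HKy.hv HKy.hlay (HKy.kgYVals_ok₁ Ny) (HKy.kgYVals_ok₂ Ny) (HKy.kgYVals_split Ny)).toFrame.N, hlen, ?_⟩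
  exact Skelφ.rootChainF_of_bridgeSchedCV₃_q hlipφ hqφ Φ.degree_le hlipψ hwsψ (fcellsV κ Φ t p O.merged (gOf κ Φ t p O gv) (fOf κ Φ t p O fv) (cOf κ Φ t p O gv fv cv) (hOf κ Φ t p O gv fv hv)) t (schedOfT κ Φ t p O.merged (gOf κ Φ t p O gv) (fOf κ Φ t p O fv) (cOf κ Φ t p O gv fv cv) (Sv κ Φ t p O.merged (gOf κ Φ t p O gv) (fOf κ Φ t p O fv) q)) (bOf κ Φ t p O gv fv bv) q κ.δ (((1 : Fin 2), true) : MDir) (Or.inl rfl) hRQ hRB hRQ' hRM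
    (fun c => Skelφ.pgramPrismFin G (KS.φK Φ t O.D O.DT.toDataN O.ori mk) c (KS.nKit O.merged mk) (KS.hKit t O.merged mk) (3 * KS.ℓKit t O.merged mk)
      (KS.RK t O.merged mk + D)) hRg hRgcard
    (Nat.one_le_pow _ _ (Nat.succ_pos _)) (fun c => O.merged.Λ (hP.prox c)) O.merged.k hΛRgK (hzconnK_of_atQPx hAt' hP hDk) hcz hZρk hρπ hZfoot hZk hZk₁
    B hB (KS0.kit0N (KS.NQ Φ) t Dk mkP ((Mu Dk : ℤ) + 2) (KS0.r₀0N (KS.NQ Φ) t Dk mkP Rb)) hPNb rfl hdDb hDρb (by simpa using hKCmaxb) ((KS0.R'0N_eq κ Φ (KS.NQ Φ) t p Dk mkP).2.1.le.trans hBR') (KS0.R'0N_eq κ Φ (KS.NQ Φ) t p Dk mkP).2.2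
    hwideb hdwb hDwb hTb hr₀b hr₀bR hrsb hcSb ((hreach0 _ _).trans hBR') hreachb le_rfl hRbπ Qb Fb hQb hFb (KS0.kk0N κ Φ (KS.NQ Φ) t p Dk mkP) hNk
    hn1 c₁ (Or.inl rfl) hκL (Skelφ.kgCorrSched (HKx.kgVals_ok₁ Nx) (HKx.kgVals_ok₂ Nx) (HKx.kgVals_split Nx)) c₂ (Or.inl rfl) (Skelφ.kgCorrSchedY HKy.hn HKy.hv HKy.hlay (HKy.kgYVals_ok₁ Ny) (HKy.kgYVals_ok₂ Ny) (HKy.kgYVals_split Ny)) (KS0.kit0N (KS.NQ Φ) t Dk mkP ((Mu Dk + 1 : ℕ) * (Skelφ.shearUnit (nL κ Φ t p O.merged (gOf κ Φ t p O gv) (fOf κ Φ t p O fv)) (hL κ Φ t p O.merged (gOf κ Φ t p O gv) (fOf κ Φ t p O fv)) : ℤ) + 1) (KS0.r₀0N (KS.NQ Φ) t Dk mkP (RL κ Φ t p O gv fv + D))) hPN rfl hdD hDρ hKCmax hT hr₀ hr₀R hrs hcS hreach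
    (KS0.tanOff_kit0N (KS.NQ Φ) t Dk mkP _ _).le (KS0.R'0N_eq κ Φ (KS.NQ Φ) t p Dk mkP).2.2 (KS0.R'0N_eq κ Φ (KS.NQ Φ) t p Dk mkP).2.1.le (KS0.R'0N_eq κ Φ (KS.NQ Φ) t p Dk mkP).2.1.le
    (hreach0 _ _) (hreach0 _ _) (KS0.kk0N κ Φ (KS.NQ Φ) t p Dk mkP) hNk hc₁ hRdepth hc₂ hRdepth₃
    hfoot₁ hfoot₂ hfoot₃ hclear₁ hclear₂ hclear₃ hTne₁ hx hx₂ hlastf hδ0 le_rfl hlink hQπ hQfoot hT₀ hcount hcount hk hk hbridge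
    (fun hWD => Skelφ.hrouteSW_kgCorr (HKx.kgVals_ok₁ Nx) (HKx.kgVals_ok₂ Nx) (HKx.kgVals_split Nx) hn1 c₁ (Or.inl rfl) le_rfl hRLπ _ hWD
      (fun c => O.merged.Λ (hP.prox c)) O.merged.k (hlongK_of_atQ3Px hAt' hP hkit hnL) (hlongYK_of_atQ3Px hAt' hP hkit hnL))
    (fun hWD => Skelφ.hrouteSW_kgCorrY HKy.hn HKy.hv HKy.hlay (HKy.kgYVals_ok₁ Ny) (HKy.kgYVals_ok₂ Ny) (HKy.kgYVals_split Ny) c₂ (Or.inl rfl) le_rfl hRLπ _ hWD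
      (fun c => O.merged.Λ (hP.prox c)) O.merged.k (hlongK_of_atQ3Px hAt' hP hkit hnL) (hlongYK_of_atQ3Px hAt' hP hkit hnL))
    hR₁ hR₁b hR₁r hDm

end NegB

end PlanarSkeletonFrmQuasi

end Transplant

end Summit.CriticalPhenomena.PercolationContinuityZ3.Theorems

end
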